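import Literature.AlgebraicTopology.SingularHomology.RelativeMayerVietorisOpen
import Literature.AlgebraicTopology.SingularHomology.LocalHomologyOfSetTransfer
import Literature.AlgebraicTopology.SingularHomology.TripleSequence
import HarnessLib

/-!
# The relative Mayer–Vietoris sequence of the pairs `(U, U ∖ S)`, `(V, V ∖ S)` for open `U`, `V`
# and closed `S`, in Mathlib's model

A. Hatcher, *Algebraic Topology* (2002), §2.2, p. 152 (relative Mayer–Vietoris sequence for a
pair `(A ∪ B, C ∪ D)`), in the case `C = A ∖ S`, `D = B ∖ S` for a fixed closed `S`:

  `⋯ → H_q(U ∩ V | S) → H_q(U | S) ⊕ H_q(V | S) → H_q(U ∪ V | S) → H_{q-1}(U ∩ V | S) → ⋯`,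

`H_q(W | S) = H_q(W, W ∖ S)` the local homology of the open subspace `W` at `S ∩ W`
(`localHomologyOfSet R M ↥W (val ⁻¹' S) q`, Mathlib's model, `Orientation.lean`), all maps induced
by inclusions of open sets (maps of pairs). This file transports the concrete common-subspace
sequence of `RelativeMayerVietorisOpen.lean` (subcomplexes `π(C(W ∪ Sᶜ)) ⊆ C(X)/C(X ∖ S)`) to this
model:

* `Subcomplex.isIso_π_bot` — `L ⟶ L/0` is an isomorphism;
* `relOpenMV.ofPair W : C(↥W)/C(W ↓∩ A) ⟶ π(C(W))` (`A ⊆ W`), an ISOMORPHISM of complexes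
  (`isIso_ofPair`; `subspaceLift`, `chainsInSub_preimage_val_eq_comap_lift`,
  `Subcomplex.isIso_quotMapToMapπ`), natural in `W` (`quotMap_comp_ofPair`);
* `relOpenMV.θ W q : H_q(↥W | S) ⟶ H_q(π(C(W)))` for `Sᶜ ⊆ W`, an isomorphism natural in `W`
  (`map_comp_θ`; through `relativeSingularHomology.concreteIso`, `map_eq_concrete`);
* `localHomologyOfSet.isIso_map_subsetInclusion_of_inter_subset` — **excision off `S`**: for `W`
  open, `S` closed and `W ⊆ W'` with `W' ∩ S ⊆ W`, `H_q(↥W | S) ≅ H_q(↥W' | S)` (in particular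
  `W' = W ∪ Sᶜ`);
* `pairMV.hIn`, `pairMV.hDiff` — the maps `x ↦ (x, x)` and `(y, z) ↦ y - z` of the sequence above;
  **`pairMV.h_exact₂`** (exactness at `H_q(U | S) ⊕ H_q(V | S)`),
  **`pairMV.hDiff_surjective_of_isZero`** (`H_{q+1}(U | S) ⊕ H_{q+1}(V | S) → H_{q+1}(U ∪ V | S)` is
  onto when `H_q(U ∩ V | S) = 0`) and `pairMV.hDiff_zero_surjective`, for `U`, `V` open and `S`
  closed — by the ladder of isomorphisms `θ ∘ (excision)` from `relOpenMV.h_exact₂`,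
  `relOpenMV.hDiff_surjective_of_subsingleton`, `relOpenMV.hDiff_zero_surjective`.

Everything is proved; no named facts. (The connecting map and the remaining two exactness
statements transport the same way and are left to a consumer that needs them.)

## References

* [HatcherAT2002] A. Hatcher, Algebraic Topology, CUP 2002, §2.2 p. 152 (relative
  Mayer–Vietoris), Thm. 2.20 (excision), §3.3 p. 233 (`H(X | A)`).
-/

noncomputable section

-- as in `SingularChainsConcrete` / `LocalHomology`: chains of the concrete complex are `Finsupp`s
-- up to unfolding of semireducible definitions
set_option backward.isDefEq.respectTransparency false

open CategoryTheory Limits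

universe u v w t

namespace Literature.AlgebraicTopology.SingularHomology

/-! ### `L ⟶ L/0` is an isomorphism -/

namespace Subcomplex

variable {R : Type v} [CommRing R]
variable {β : Type t} {c : ComplexShape β} {K : HomologicalComplex (ModuleCat.{w} R) c}

/-- The quotient map `K ⟶ K/⊥` by the zero subcomplex is an isomorphism. [folklore] -/
instance isIso_π_bot : IsIso (⊥ : Subcomplex K).π := by
  haveI : ∀ i, IsIso ((⊥ : Subcomplex K).π.f i) := fun i => by
    rw [ConcreteCategory.isIso_iff_bijective]
    refine ⟨fun x y hxy => ?_, (⊥ : Subcomplex K).π_f_surjective i⟩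
    have h := ((⊥ : Subcomplex K).π_f_eq_π_f_iff i x y).1 hxy
    rw [bot_apply, Submodule.mem_bot, sub_eq_zero] at h
    exact h
  exact HomologicalComplex.Hom.isIso_of_components _

end Subcomplex

/-! ### The concrete relative complex of the pair `(↥W, W ↓∩ A)` versus `π(C(W)) ⊆ C(X)/C(A)` -/

namespace relOpenMV

variable (R : Type v) [CommRing R] (M : Type v) [AddCommGroup M] [Module R M]
variable {X : Type u} [TopologicalSpace X] {A : Set X}

/-- The membership condition making `toMapπ` descend to `S/(𝒜 ∩ S) → π(S)/0`. [folklore] -/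
lemma toMapπ_le_comap (𝒜 S : Subcomplex (csingularChainComplex R M X)) :
    𝒜.comap S.ι ≤ (⊥ : Subcomplex (Subcomplex.mapπ 𝒜 S).toComplex).comap (Subcomplex.toMapπ 𝒜 S) :=
  fun i x hx ↦ by
    rw [Subcomplex.mem_comap, Subcomplex.bot_apply, Submodule.mem_bot]
    exact (Subcomplex.toMapπ_f_eq_zero_iff 𝒜 S i x).2 hx

variable (A) in
/-- **`C(↥W)/C(W ↓∩ A) ⟶ π(C(W))`**: the concrete relative chain complex of the pair
`(↥W, val ⁻¹' A)` mapped to the image of `C(W)` in `C(X)/C(A)` — the composite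
`C(↥W)/C(W ↓∩ A) ≅ C(W)/(C(A) ⊓ C(W)) ≅ π(C(W))/0 ≅ π(C(W))` (`subspaceLift`, the first isomorphism
theorem `Subcomplex.isIso_quotMapToMapπ`, and `K/0 ≅ K`). For `A ⊆ W` all three are
isomorphisms (`isIso_ofPair`). (Hatcher 2002, §2.1–2.2: `C(A, C) = C(A)/C(C)`.)
[cite: HatcherAT2002, §2.2 p. 152] -/
def ofPair (W : Set X) :
    (chainsInSub R M (↥W) (Subtype.val ⁻¹' A)).quotient ⟶ (relSub R M A W).toComplex :=
  Subcomplex.quotMap (subspaceLift R M X W) (chainsInSub R M (↥W) (Subtype.val ⁻¹' A))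
      ((chainsInSub R M X A).comap (chainsInSub R M X W).ι)
      (chainsInSub_preimage_val_eq_comap_lift R M W A).le ≫
    Subcomplex.quotMap (Subcomplex.toMapπ (chainsInSub R M X A) (chainsInSub R M X W))
      ((chainsInSub R M X A).comap (chainsInSub R M X W).ι) ⊥ (toMapπ_le_comap R M _ _) ≫
    inv (⊥ : Subcomplex (relSub R M A W).toComplex).π

/-- `ofPair` on representatives: `π ≫ ofPair = subspaceLift ≫ toMapπ`, i.e. the relative class of a
chain `c` of `↥W` goes to `π(c)` viewed in `C(X)/C(A)`. [folklore] -/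
@[reassoc]
lemma π_comp_ofPair (W : Set X) :
    (chainsInSub R M (↥W) (Subtype.val ⁻¹' A)).π ≫ ofPair R M A W =
      subspaceLift R M X W ≫ Subcomplex.toMapπ (chainsInSub R M X A) (chainsInSub R M X W) := by
  rw [ofPair, Subcomplex.π_quotMap_assoc, Subcomplex.π_quotMap_assoc, IsIso.hom_inv_id,
    Category.comp_id]

/-- `ofPair` is an isomorphism of complexes (for `A ⊆ W`; in fact always, the first map being an
isomorphism by `chainsInSub_preimage_val_eq_comap_lift`). [cite: HatcherAT2002, §2.2 p. 152] -/
instance isIso_ofPair (W : Set X) : IsIso (ofPair R M A W) := by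
  haveI := Subcomplex.isIso_quotMap (subspaceLift R M X W)
    (chainsInSub R M (↥W) (Subtype.val ⁻¹' A)) ((chainsInSub R M X A).comap (chainsInSub R M X W).ι)
    (chainsInSub_preimage_val_eq_comap_lift R M W A)
  haveI : IsIso (Subcomplex.quotMap (Subcomplex.toMapπ (chainsInSub R M X A) (chainsInSub R M X W))
      ((chainsInSub R M X A).comap (chainsInSub R M X W).ι) ⊥ (toMapπ_le_comap R M _ _)) :=
    Subcomplex.isIso_quotMapToMapπ (chainsInSub R M X A) (chainsInSub R M X W)
  rw [ofPair]
  infer_instance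

/-- An inclusion `W ⊆ W'` is a map of pairs `(↥W, W ↓∩ A) → (↥W', W' ↓∩ A)`. [folklore] -/
lemma mapsTo_inclusion_preimage {W W' : Set X} (h : W ⊆ W') (B : Set X) :
    Set.MapsTo (subsetInclusion h) (Subtype.val ⁻¹' B : Set ↥W) (Subtype.val ⁻¹' B : Set ↥W') :=
  fun _ hx ↦ hx

/-- **Naturality of `ofPair` in `W`**: for `W ⊆ W'` the map of pairs `(↥W, W ↓∩ A) → (↥W', W' ↓∩ A)`
on concrete relative chains corresponds to the inclusion `π(C(W)) ≤ π(C(W'))`. [folklore] -/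
@[reassoc]
lemma quotMap_comp_ofPair {W W' : Set X} (h : W ⊆ W') :
    Subcomplex.quotMap (csingularChainComplex.map R M (subsetInclusion h))
        (chainsInSub R M (↥W) (Subtype.val ⁻¹' A)) (chainsInSub R M (↥W') (Subtype.val ⁻¹' A))
        (chainsInSub_le_comap_map R M (subsetInclusion h) (mapsTo_inclusion_preimage h A)) ≫
      ofPair R M A W' =
    ofPair R M A W ≫ Subcomplex.incl (relSub_mono R M (A := A) h) := by
  rw [← cancel_epi (chainsInSub R M (↥W) (Subtype.val ⁻¹' A)).π, Subcomplex.π_quotMap_assoc,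
    π_comp_ofPair, π_comp_ofPair_assoc, ← Subcomplex.incl_toMapπ _ (chainsInSub_mono R M h),
    clocalHomology.subspaceLift_comp_incl_assoc]

/-! ### Homology: `H_q(↥W | S) ≅ H_q(π(C(W)))` for `Sᶜ ⊆ W`, naturally in `W` -/

variable {S : Set X}

/-- **The comparison `θ : H_q(↥W | S) ⟶ H_q(π(C(W)))`** (`π(C(W)) ⊆ C(X)/C(X ∖ S)`), the composite
of `relativeSingularHomology.concreteIso` (Mathlib's model to the concrete quotient complex of the
pair `(↥W, W ↓∖ S)`) and `H_q(ofPair)`; an isomorphism (`isIso_θ`). [cite: HatcherAT2002, §2.2 p. 152] -/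
def θ (W : Set X) (q : ℕ) :
    localHomologyOfSet R M (↥W) (Subtype.val ⁻¹' S) q ⟶ (relSub R M Sᶜ W).toComplex.homology q :=
  (relativeSingularHomology.concreteIso R M (↥W) (Subtype.val ⁻¹' S)ᶜ q).hom ≫
    HomologicalComplex.homologyMap (ofPair R M Sᶜ W) q

/-- `θ` is an isomorphism. [cite: HatcherAT2002, §2.2 p. 152] -/
instance isIso_θ (W : Set X) (q : ℕ) : IsIso (θ R M (S := S) W q) := by
  rw [θ]
  infer_instance

/-- An inclusion `W ⊆ W'` is a map of pairs `(↥W, W ↓∖ S) → (↥W', W' ↓∖ S)`. [folklore] -/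
lemma mapsTo_inclusion_compl {W W' : Set X} (h : W ⊆ W') (S : Set X) :
    Set.MapsTo (subsetInclusion h) (Subtype.val ⁻¹' S : Set ↥W)ᶜ (Subtype.val ⁻¹' S : Set ↥W')ᶜ :=
  fun _ hx ↦ hx

/-- **Naturality of `θ`**: for `W ⊆ W'`, `θ_{W'} ∘ (↥W → ↥W')_* = H_q(incl) ∘ θ_W`. [folklore] -/
@[reassoc]
lemma map_comp_θ {W W' : Set X} (h : W ⊆ W') (q : ℕ) :
    relativeSingularHomology.map R M (subsetInclusion h) (mapsTo_inclusion_compl h S) q ≫ θ R M W' q =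
      θ R M W q ≫ HomologicalComplex.homologyMap (Subcomplex.incl (relSub_mono R M (A := Sᶜ) h)) q := by
  have key := congrArg (fun φ ↦ HomologicalComplex.homologyMap φ q) (quotMap_comp_ofPair R M (A := Sᶜ) h)
  simp only [HomologicalComplex.homologyMap_comp] at key
  rw [θ, θ, relativeSingularHomology.map_eq_concrete R M (subsetInclusion h) (mapsTo_inclusion_compl h S) q]
  simp only [Category.assoc, Iso.inv_hom_id_assoc]
  rw [← key]
  rfl

end relOpenMV

/-! ### Excision off `S`: `H_q(↥W | S) ≅ H_q(↥W' | S)` when `W' ∩ S ⊆ W ⊆ W'` -/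

namespace localHomologyOfSet

variable (R : Type v) [CommRing R] (M : Type v) [AddCommGroup M] [Module R M]
variable {X : Type u} [TopologicalSpace X] {S : Set X}

/-- **Excision off a closed set**: for `W` open, `S` closed and `W ⊆ W'` with `W' ∩ S ⊆ W`, the
inclusion induces isomorphisms `H_q(↥W | S) ≅ H_q(↥W' | S)` (`H_q(↥W | S) = H_q(W, W ∖ S)`): inside
`↥W'` the closed set `W' ↓∩ S` lies in the open `W' ↓∩ W ≃ₜ W` (Hatcher 2002, Thm. 2.20 / §3.3:
`H(X | K) ≅ H(Ω | K)` for `Ω` an open neighbourhood of the closed `K`). In particular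
`H_q(↥W | S) ≅ H_q(↥(W ∪ Sᶜ) | S)`. [cite: HatcherAT2002, Thm. 2.20] -/
theorem isIso_map_subsetInclusion_of_inter_subset {W W' : Set X} (hW : IsOpen W) (hS : IsClosed S)
    (h : W ⊆ W') (h' : W' ∩ S ⊆ W) (q : ℕ) :
    IsIso (relativeSingularHomology.map R M (subsetInclusion h)
      (relOpenMV.mapsTo_inclusion_compl h S) q :
        localHomologyOfSet R M (↥W) (Subtype.val ⁻¹' S) q ⟶ localHomologyOfSet R M (↥W') (Subtype.val ⁻¹' S) q) := by
  -- inside `Y = ↥W'`: `Ω = W' ↓∩ W` open, `K = W' ↓∩ S` closed, `K ⊆ Ω`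
  have hΩ : IsOpen (Subtype.val ⁻¹' W : Set ↥W') := hW.preimage continuous_subtype_val
  have hK : IsClosed (Subtype.val ⁻¹' S : Set ↥W') := hS.preimage continuous_subtype_val
  have hKΩ : (Subtype.val ⁻¹' S : Set ↥W') ⊆ Subtype.val ⁻¹' W := fun y hy ↦ h' ⟨y.2, hy⟩
  have h1 := isIso_map_subsetIncl_of_isClosed R M hΩ hK hKΩ q
  -- `↥Ω ≃ₜ ↥W`, and the inclusion `↥W → ↥W'` is `(↥Ω → ↥W') ∘ e.symm`
  set e := preimageValHomeomorphOfSubset (X := X) h with he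
  have hes : Set.MapsTo (e.symm : C(↥W, ↥(Subtype.val ⁻¹' W : Set ↥W')))
      (Subtype.val ⁻¹' S : Set ↥W)ᶜ
      ((Subtype.val ⁻¹' (Subtype.val ⁻¹' S : Set ↥W') : Set ↥(Subtype.val ⁻¹' W : Set ↥W'))ᶜ) :=
    fun _ hx ↦ hx
  have hes' : Set.MapsTo (e : C(↥(Subtype.val ⁻¹' W : Set ↥W'), ↥W))
      ((Subtype.val ⁻¹' (Subtype.val ⁻¹' S : Set ↥W') : Set ↥(Subtype.val ⁻¹' W : Set ↥W'))ᶜ)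
      (Subtype.val ⁻¹' S : Set ↥W)ᶜ :=
    fun _ hx ↦ hx
  have h2 := relativeSingularHomology.isIso_map_homeomorph R M e.symm hes hes' q
  have hfac : relativeSingularHomology.map R M (subsetInclusion h) (relOpenMV.mapsTo_inclusion_compl h S) q =
      relativeSingularHomology.map R M (e.symm : C(↥W, ↥(Subtype.val ⁻¹' W : Set ↥W'))) hes q ≫
        relativeSingularHomology.map R M (subsetIncl (Subtype.val ⁻¹' W : Set ↥W'))
          (mapsTo_val_compl _ _) q := by
    rw [← relativeSingularHomology.map_comp]
    rfl
  rw [hfac]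
  haveI := h1
  haveI := h2
  infer_instance

end localHomologyOfSet

/-! ### The relative Mayer–Vietoris sequence of `(U, U ∖ S)`, `(V, V ∖ S)` -/

namespace pairMV

variable (R : Type v) [CommRing R] (M : Type v) [AddCommGroup M] [Module R M]
variable {X : Type u} [TopologicalSpace X] (S U V : Set X)

/-- **`H_q(U ∩ V | S) → H_q(U | S) × H_q(V | S)`, `x ↦ (x, x)`** (maps of pairs induced by the two
inclusions; Hatcher 2002, §2.2 p. 152). [cite: HatcherAT2002, §2.2 p. 152] -/
def hIn (q : ℕ) : localHomologyOfSet R M (↥(U ∩ V)) (Subtype.val ⁻¹' S) q →ₗ[R]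
    localHomologyOfSet R M (↥U) (Subtype.val ⁻¹' S) q × localHomologyOfSet R M (↥V) (Subtype.val ⁻¹' S) q :=
  LinearMap.prod
    (relativeSingularHomology.map R M (subsetInclusion Set.inter_subset_left)
      (relOpenMV.mapsTo_inclusion_compl Set.inter_subset_left S) q).hom
    (relativeSingularHomology.map R M (subsetInclusion Set.inter_subset_right)
      (relOpenMV.mapsTo_inclusion_compl Set.inter_subset_right S) q).hom

/-- **`H_q(U | S) × H_q(V | S) → H_q(U ∪ V | S)`, `(y, z) ↦ y - z`** (Hatcher 2002, §2.2 p. 152).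
[cite: HatcherAT2002, §2.2 p. 152] -/
def hDiff (q : ℕ) :
    localHomologyOfSet R M (↥U) (Subtype.val ⁻¹' S) q × localHomologyOfSet R M (↥V) (Subtype.val ⁻¹' S) q →ₗ[R]
      localHomologyOfSet R M (↥(U ∪ V)) (Subtype.val ⁻¹' S) q :=
  (relativeSingularHomology.map R M (subsetInclusion Set.subset_union_left)
      (relOpenMV.mapsTo_inclusion_compl Set.subset_union_left S) q).hom ∘ₗ LinearMap.fst R _ _ -
    (relativeSingularHomology.map R M (subsetInclusion Set.subset_union_right)
      (relOpenMV.mapsTo_inclusion_compl Set.subset_union_right S) q).hom ∘ₗ LinearMap.snd R _ _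

variable {S U V}

/-- `hIn` unfolded. [folklore] -/
@[simp] lemma hIn_apply (q : ℕ) (x : localHomologyOfSet R M (↥(U ∩ V)) (Subtype.val ⁻¹' S) q) :
    hIn R M S U V q x =
      (relativeSingularHomology.map R M (subsetInclusion Set.inter_subset_left)
          (relOpenMV.mapsTo_inclusion_compl Set.inter_subset_left S) q x,
        relativeSingularHomology.map R M (subsetInclusion Set.inter_subset_right)
          (relOpenMV.mapsTo_inclusion_compl Set.inter_subset_right S) q x) :=
  rfl

/-- `hDiff` unfolded. [folklore] -/
@[simp] lemma hDiff_apply (q : ℕ) (y : localHomologyOfSet R M (↥U) (Subtype.val ⁻¹' S) q)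
    (z : localHomologyOfSet R M (↥V) (Subtype.val ⁻¹' S) q) :
    hDiff R M S U V q (y, z) =
      relativeSingularHomology.map R M (subsetInclusion Set.subset_union_left)
          (relOpenMV.mapsTo_inclusion_compl Set.subset_union_left S) q y -
        relativeSingularHomology.map R M (subsetInclusion Set.subset_union_right)
          (relOpenMV.mapsTo_inclusion_compl Set.subset_union_right S) q z :=
  rfl

/-! #### The ladder to the concrete sequence -/

omit [TopologicalSpace X] in
/-- `(U ∪ Sᶜ) ∩ (V ∪ Sᶜ) = (U ∩ V) ∪ Sᶜ`. [folklore] -/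
lemma union_compl_inter_union_compl (S U V : Set X) : (U ∪ Sᶜ) ∩ (V ∪ Sᶜ) = (U ∩ V) ∪ Sᶜ :=
  (Set.inter_union_distrib_right U V Sᶜ).symm

omit [TopologicalSpace X] in
/-- `(U ∪ Sᶜ) ∪ (V ∪ Sᶜ) = (U ∪ V) ∪ Sᶜ`. [folklore] -/
lemma union_compl_union_union_compl (S U V : Set X) : (U ∪ Sᶜ) ∪ (V ∪ Sᶜ) = (U ∪ V) ∪ Sᶜ :=
  Set.union_union_distrib_right U V Sᶜ |>.symm

/-- The comparison map `E_W : H_q(↥W | S) ⟶ H_q(π(C(W')))` for `W ⊆ W'`: excision to `W'` followed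
by `θ`. [folklore] -/
abbrev E {W W' : Set X} (h : W ⊆ W') (q : ℕ) :
    localHomologyOfSet R M (↥W) (Subtype.val ⁻¹' S) q ⟶ (relOpenMV.relSub R M Sᶜ W').toComplex.homology q :=
  relativeSingularHomology.map R M (subsetInclusion h) (relOpenMV.mapsTo_inclusion_compl h S) q ≫
    relOpenMV.θ R M W' q

/-- `E_W` is an isomorphism when `W` is open, `S` closed and `W' ∩ S ⊆ W`. [folklore] -/
lemma isIso_E {W W' : Set X} (hW : IsOpen W) (hS : IsClosed S) (h : W ⊆ W') (h' : W' ∩ S ⊆ W)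
    (q : ℕ) : IsIso (E R M (S := S) h q) := by
  haveI := localHomologyOfSet.isIso_map_subsetInclusion_of_inter_subset R M hW hS h h' q
  exact IsIso.comp_isIso

/-- Naturality of `E`: for `W₁ ⊆ W₂`, `W₁ ⊆ W₁'`, `W₂ ⊆ W₂'`, `W₁' ⊆ W₂'` the comparison maps commute
with the maps induced by the inclusions. [folklore] -/
lemma map_comp_E {W₁ W₂ W₁' W₂' : Set X} (h₁ : W₁ ⊆ W₁') (h₂ : W₂ ⊆ W₂') (h₁₂ : W₁ ⊆ W₂)
    (h₁₂' : W₁' ⊆ W₂') (q : ℕ) :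
    relativeSingularHomology.map R M (subsetInclusion h₁₂) (relOpenMV.mapsTo_inclusion_compl h₁₂ S) q ≫
        E R M h₂ q =
      E R M h₁ q ≫ HomologicalComplex.homologyMap
        (Subcomplex.incl (relOpenMV.relSub_mono R M (A := Sᶜ) h₁₂')) q := by
  change _ ≫ _ ≫ _ = (_ ≫ _) ≫ _
  rw [Category.assoc, ← relOpenMV.map_comp_θ R M h₁₂' q, ← relativeSingularHomology.map_comp_assoc,
    ← relativeSingularHomology.map_comp_assoc]
  rfl

/-- `map_comp_E` on elements. [folklore] -/
lemma E_map_apply {W₁ W₂ W₁' W₂' : Set X} (h₁ : W₁ ⊆ W₁') (h₂ : W₂ ⊆ W₂') (h₁₂ : W₁ ⊆ W₂)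
    (h₁₂' : W₁' ⊆ W₂') (q : ℕ) (x : localHomologyOfSet R M (↥W₁) (Subtype.val ⁻¹' S) q) :
    E R M h₂ q (relativeSingularHomology.map R M (subsetInclusion h₁₂)
        (relOpenMV.mapsTo_inclusion_compl h₁₂ S) q x) =
      HomologicalComplex.homologyMap (Subcomplex.incl (relOpenMV.relSub_mono R M (A := Sᶜ) h₁₂')) q
        (E R M h₁ q x) :=
  congrArg (fun φ ↦ (φ : localHomologyOfSet R M (↥W₁) (Subtype.val ⁻¹' S) q ⟶ _) x)
    (map_comp_E R M (S := S) h₁ h₂ h₁₂ h₁₂' q)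

variable (S U V) in
/-- The linear equivalence underlying an `E` known to be an isomorphism. [folklore] -/
abbrev Eₗ {W W' : Set X} (h : W ⊆ W') (q : ℕ) [IsIso (E R M (S := S) h q)] :
    localHomologyOfSet R M (↥W) (Subtype.val ⁻¹' S) q ≃ₗ[R] (relOpenMV.relSub R M Sᶜ W').toComplex.homology q :=
  (asIso (E R M (S := S) h q)).toLinearEquiv

omit [TopologicalSpace X] in
/-- Inclusions used below: `U ∩ V ⊆ (U ∪ Sᶜ) ∩ (V ∪ Sᶜ)` etc. [folklore] -/
lemma inter_subset_inter' (S U V : Set X) : U ∩ V ⊆ (U ∪ Sᶜ) ∩ (V ∪ Sᶜ) :=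
  Set.inter_subset_inter Set.subset_union_left Set.subset_union_left

omit [TopologicalSpace X] in
/-- `U ∪ V ⊆ (U ∪ Sᶜ) ∪ (V ∪ Sᶜ)`. [folklore] -/
lemma union_subset_union' (S U V : Set X) : U ∪ V ⊆ (U ∪ Sᶜ) ∪ (V ∪ Sᶜ) :=
  Set.union_subset_union Set.subset_union_left Set.subset_union_left

/-- **Exactness at `H_q(U | S) ⊕ H_q(V | S)`** for `U`, `V` open and `S` closed (Hatcher 2002, §2.2
p. 152): `(y, z)` has `y|^{U ∪ V} = z|^{U ∪ V}` iff it comes from `H_q(U ∩ V | S)`.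
[cite: HatcherAT2002, §2.2 p. 152] -/
theorem h_exact₂ (hU : IsOpen U) (hV : IsOpen V) (hS : IsClosed S) (q : ℕ) :
    Function.Exact (hIn R M S U V q) (hDiff R M S U V q) := by
  -- the concrete sequence for `U' = U ∪ Sᶜ`, `V' = V ∪ Sᶜ`
  have hA : Sᶜ ⊆ U ∪ Sᶜ := Set.subset_union_right
  have hU' : IsOpen (U ∪ Sᶜ) := hU.union hS.isOpen_compl
  have hV' : IsOpen (V ∪ Sᶜ) := hV.union hS.isOpen_compl
  have hex := relOpenMV.h_exact₂ R M (A := Sᶜ) (V := V ∪ Sᶜ) hA hU' hV' q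
  -- the three comparison isomorphisms
  haveI i₁ : IsIso (E R M (S := S) (inter_subset_inter' S U V) q) :=
    isIso_E R M (hU.inter hV) hS _ (fun x hx ↦ by
      rcases hx with ⟨⟨hxU | hxS, hxV | hxS'⟩, hxS''⟩
      · exact ⟨hxU, hxV⟩
      · exact absurd hxS'' hxS'
      · exact absurd hxS'' hxS
      · exact absurd hxS'' hxS) q
  haveI i₂ : IsIso (E R M (S := S) (Set.subset_union_left : U ⊆ U ∪ Sᶜ) q) :=
    isIso_E R M hU hS _ (fun x hx ↦ hx.1.elim id fun h ↦ absurd hx.2 h) q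
  haveI i₃ : IsIso (E R M (S := S) (Set.subset_union_left : V ⊆ V ∪ Sᶜ) q) :=
    isIso_E R M hV hS _ (fun x hx ↦ hx.1.elim id fun h ↦ absurd hx.2 h) q
  haveI i₄ : IsIso (E R M (S := S) (union_subset_union' S U V) q) :=
    isIso_E R M (hU.union hV) hS _ (fun x hx ↦ by
      rcases hx with ⟨(hxU | hxS) | (hxV | hxS), hxS'⟩
      · exact Or.inl hxU
      · exact absurd hxS' hxS
      · exact Or.inr hxV
      · exact absurd hxS' hxS) q
  refine (Function.Exact.iff_of_ladder_linearEquiv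
    (e₁ := Eₗ R M S (inter_subset_inter' S U V) q)
    (e₂ := (Eₗ R M S (Set.subset_union_left : U ⊆ U ∪ Sᶜ) q).prodCongr
      (Eₗ R M S (Set.subset_union_left : V ⊆ V ∪ Sᶜ) q))
    (e₃ := Eₗ R M S (union_subset_union' S U V) q)
    (g₁₂ := relOpenMV.hIn R M Sᶜ (U ∪ Sᶜ) (V ∪ Sᶜ) q)
    (g₂₃ := relOpenMV.hDiff R M Sᶜ (U ∪ Sᶜ) (V ∪ Sᶜ) q) ?_ ?_).mp hex
  · -- first square
    apply LinearMap.ext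
    intro x
    simp only [LinearMap.comp_apply, LinearEquiv.coe_coe, LinearEquiv.prodCongr_apply,
      hIn_apply, relOpenMV.hIn_apply, Iso.toLinearEquiv_apply, asIso_hom]
    exact Prod.ext
      (E_map_apply R M (inter_subset_inter' S U V) Set.subset_union_left Set.inter_subset_left
        Set.inter_subset_left q x).symm
      (E_map_apply R M (inter_subset_inter' S U V) Set.subset_union_left Set.inter_subset_right
        Set.inter_subset_right q x).symm
  · -- second square
    apply LinearMap.ext
    rintro ⟨y, z⟩
    simp only [LinearMap.comp_apply, LinearEquiv.coe_coe, LinearEquiv.prodCongr_apply,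
      hDiff_apply, relOpenMV.hDiff_apply, Iso.toLinearEquiv_apply, asIso_hom, map_sub]
    rw [E_map_apply R M Set.subset_union_left (union_subset_union' S U V) Set.subset_union_left
        Set.subset_union_left q y,
      E_map_apply R M Set.subset_union_left (union_subset_union' S U V) Set.subset_union_right
        Set.subset_union_right q z]

/-- **`H_{q+1}(U | S) ⊕ H_{q+1}(V | S) → H_{q+1}(U ∪ V | S)` is onto when `H_q(U ∩ V | S) = 0`**, for
`U`, `V` open and `S` closed (exactness of the relative Mayer–Vietoris sequence at
`H_{q+1}(U ∪ V | S)`; Hatcher 2002, §2.2 p. 152). [cite: HatcherAT2002, §2.2 p. 152] -/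
theorem hDiff_surjective_of_isZero (hU : IsOpen U) (hV : IsOpen V) (hS : IsClosed S) (q : ℕ)
    (h0 : IsZero (localHomologyOfSet R M (↥(U ∩ V)) (Subtype.val ⁻¹' S) q)) :
    Function.Surjective (hDiff R M S U V (q + 1)) := by
  have hA : Sᶜ ⊆ U ∪ Sᶜ := Set.subset_union_right
  have hU' : IsOpen (U ∪ Sᶜ) := hU.union hS.isOpen_compl
  have hV' : IsOpen (V ∪ Sᶜ) := hV.union hS.isOpen_compl
  -- vanishing transports to the concrete group of `(U ∪ Sᶜ) ∩ (V ∪ Sᶜ)`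
  haveI i₁ : IsIso (E R M (S := S) (inter_subset_inter' S U V) q) :=
    isIso_E R M (hU.inter hV) hS _ (fun x hx ↦ by
      rcases hx with ⟨⟨hxU | hxS, hxV | hxS'⟩, hxS''⟩
      · exact ⟨hxU, hxV⟩
      · exact absurd hxS'' hxS'
      · exact absurd hxS'' hxS
      · exact absurd hxS'' hxS) q
  haveI : Subsingleton (localHomologyOfSet R M (↥(U ∩ V)) (Subtype.val ⁻¹' S) q) :=
    ModuleCat.subsingleton_of_isZero h0
  have hsub : Subsingleton ((relOpenMV.relSub R M Sᶜ ((U ∪ Sᶜ) ∩ (V ∪ Sᶜ))).toComplex.homology q) :=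
    (Eₗ R M S (inter_subset_inter' S U V) q).symm.toEquiv.subsingleton
  have hsurj := relOpenMV.hDiff_surjective_of_subsingleton R M (A := Sᶜ) (V := V ∪ Sᶜ) hA hU' hV' q hsub
  -- and surjectivity transports back
  haveI i₂ : IsIso (E R M (S := S) (Set.subset_union_left : U ⊆ U ∪ Sᶜ) (q + 1)) :=
    isIso_E R M hU hS _ (fun x hx ↦ hx.1.elim id fun h ↦ absurd hx.2 h) (q + 1)
  haveI i₃ : IsIso (E R M (S := S) (Set.subset_union_left : V ⊆ V ∪ Sᶜ) (q + 1)) :=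
    isIso_E R M hV hS _ (fun x hx ↦ hx.1.elim id fun h ↦ absurd hx.2 h) (q + 1)
  haveI i₄ : IsIso (E R M (S := S) (union_subset_union' S U V) (q + 1)) :=
    isIso_E R M (hU.union hV) hS _ (fun x hx ↦ by
      rcases hx with ⟨(hxU | hxS) | (hxV | hxS), hxS'⟩
      · exact Or.inl hxU
      · exact absurd hxS' hxS
      · exact Or.inr hxV
      · exact absurd hxS' hxS) (q + 1)
  have hsq : relOpenMV.hDiff R M Sᶜ (U ∪ Sᶜ) (V ∪ Sᶜ) (q + 1) ∘ₗ
      ((Eₗ R M S (Set.subset_union_left : U ⊆ U ∪ Sᶜ) (q + 1)).prodCongr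
        (Eₗ R M S (Set.subset_union_left : V ⊆ V ∪ Sᶜ) (q + 1))).toLinearMap =
      (Eₗ R M S (union_subset_union' S U V) (q + 1)).toLinearMap ∘ₗ hDiff R M S U V (q + 1) := by
    apply LinearMap.ext
    rintro ⟨y, z⟩
    simp only [LinearMap.comp_apply, LinearEquiv.coe_coe, LinearEquiv.prodCongr_apply,
      hDiff_apply, relOpenMV.hDiff_apply, Iso.toLinearEquiv_apply, asIso_hom, map_sub]
    rw [E_map_apply R M Set.subset_union_left (union_subset_union' S U V) Set.subset_union_left
        Set.subset_union_left (q + 1) y,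
      E_map_apply R M Set.subset_union_left (union_subset_union' S U V) Set.subset_union_right
        Set.subset_union_right (q + 1) z]
  intro x
  obtain ⟨w, hw⟩ := hsurj (Eₗ R M S (union_subset_union' S U V) (q + 1) x)
  obtain ⟨w', rfl⟩ := ((Eₗ R M S (Set.subset_union_left : U ⊆ U ∪ Sᶜ) (q + 1)).prodCongr
    (Eₗ R M S (Set.subset_union_left : V ⊆ V ∪ Sᶜ) (q + 1))).surjective w
  refine ⟨w', (Eₗ R M S (union_subset_union' S U V) (q + 1)).injective ?_⟩
  have e := congrArg (fun f ↦ f w') hsq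
  simp only [LinearMap.comp_apply, LinearEquiv.coe_coe] at e
  rw [← e, hw]

/-- **`H₀(U | S) ⊕ H₀(V | S) → H₀(U ∪ V | S)` is onto**, for `U`, `V` open and `S` closed (the
relative Mayer–Vietoris sequence ends there; Hatcher 2002, §2.2 p. 152).
[cite: HatcherAT2002, §2.2 p. 152] -/
theorem hDiff_zero_surjective (hU : IsOpen U) (hV : IsOpen V) (hS : IsClosed S) :
    Function.Surjective (hDiff R M S U V 0) := by
  have hA : Sᶜ ⊆ U ∪ Sᶜ := Set.subset_union_right
  have hU' : IsOpen (U ∪ Sᶜ) := hU.union hS.isOpen_compl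
  have hV' : IsOpen (V ∪ Sᶜ) := hV.union hS.isOpen_compl
  have hsurj := relOpenMV.hDiff_zero_surjective R M (A := Sᶜ) (V := V ∪ Sᶜ) hA hU' hV'
  haveI i₂ : IsIso (E R M (S := S) (Set.subset_union_left : U ⊆ U ∪ Sᶜ) 0) :=
    isIso_E R M hU hS _ (fun x hx ↦ hx.1.elim id fun h ↦ absurd hx.2 h) 0
  haveI i₃ : IsIso (E R M (S := S) (Set.subset_union_left : V ⊆ V ∪ Sᶜ) 0) :=
    isIso_E R M hV hS _ (fun x hx ↦ hx.1.elim id fun h ↦ absurd hx.2 h) 0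
  haveI i₄ : IsIso (E R M (S := S) (union_subset_union' S U V) 0) :=
    isIso_E R M (hU.union hV) hS _ (fun x hx ↦ by
      rcases hx with ⟨(hxU | hxS) | (hxV | hxS), hxS'⟩
      · exact Or.inl hxU
      · exact absurd hxS' hxS
      · exact Or.inr hxV
      · exact absurd hxS' hxS) 0
  have hsq : relOpenMV.hDiff R M Sᶜ (U ∪ Sᶜ) (V ∪ Sᶜ) 0 ∘ₗ
      ((Eₗ R M S (Set.subset_union_left : U ⊆ U ∪ Sᶜ) 0).prodCongr
        (Eₗ R M S (Set.subset_union_left : V ⊆ V ∪ Sᶜ) 0)).toLinearMap =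
      (Eₗ R M S (union_subset_union' S U V) 0).toLinearMap ∘ₗ hDiff R M S U V 0 := by
    apply LinearMap.ext
    rintro ⟨y, z⟩
    simp only [LinearMap.comp_apply, LinearEquiv.coe_coe, LinearEquiv.prodCongr_apply,
      hDiff_apply, relOpenMV.hDiff_apply, Iso.toLinearEquiv_apply, asIso_hom, map_sub]
    rw [E_map_apply R M Set.subset_union_left (union_subset_union' S U V) Set.subset_union_left
        Set.subset_union_left 0 y,
      E_map_apply R M Set.subset_union_left (union_subset_union' S U V) Set.subset_union_right
        Set.subset_union_right 0 z]
  intro x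
  obtain ⟨w, hw⟩ := hsurj (Eₗ R M S (union_subset_union' S U V) 0 x)
  obtain ⟨w', rfl⟩ := ((Eₗ R M S (Set.subset_union_left : U ⊆ U ∪ Sᶜ) 0).prodCongr
    (Eₗ R M S (Set.subset_union_left : V ⊆ V ∪ Sᶜ) 0)).surjective w
  refine ⟨w', (Eₗ R M S (union_subset_union' S U V) 0).injective ?_⟩
  have e := congrArg (fun f ↦ f w') hsq
  simp only [LinearMap.comp_apply, LinearEquiv.coe_coe] at e
  rw [← e, hw]

end pairMV

end Literature.AlgebraicTopology.SingularHomology
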